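import Literature.Analysis.FunctionSpaces.PolchinskiEquation
import HarnessLib

/-!
# Gaussian smoothing preserves `C_b²` bounds and moduli; second derivatives of products
# (toolkit for Bauerschmidt–Bodineau–Dagallier §3.2–3.3)

Topic `Literature/Analysis/FunctionSpaces`; seventh "proof architecture" file behind the named fact
`Polchinski.BauerschmidtBodineau_multiscaleBakryEmery` ([BBD] Theorem 3, `MultiscaleBakryEmery.lean`).
The remaining analytic steps of [BBD] §3.2–3.3 (the dual identity `−∂_t E_{ν_t} = E_{ν_t}L_t` of
Prop 8 and the entropy production formula (e:dEnt)) apply the two-scale machinery of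
`PolchinskiHeatEquation.lean` / `PolchinskiFluctuationHeat.lean` to the FAMILY of integrands
`K_t = e^{−V_t} F = Z_t · F`, `Z_t(y) = E_{C_t}[e^{−V₀(y+w)}]`, which requires bounds and moduli of
continuity of `Z_t`, `∇Z_t`, `Hess Z_t` that are UNIFORM in `t`, and the second derivative of a product of
two `C_b²` functions with explicit bounds.  This file supplies these elementary facts («the definition
(e:P-def-bis) also implies continuity since `‖P_{s,t}F‖_∞ ≤ ‖F‖_∞`», [BBD] proof of Prop 8, p0015 L5;
the regularity of `V_t` is that of `V₀` transported by Gaussian convolution, Lemma 2).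

## Main results (sorry-free; no new definitions, no new named facts)

* `norm_integral_shift_le` — `‖E_P[H(x+ζ)]‖ ≤ sup‖H‖` (any probability `P`, Banach-valued `H`).
* `norm_integral_shift_sub_integral_shift_le` — an `(ε,δ)`-modulus of `H` is an `(ε,δ)`-modulus of
  `x ↦ E_P[H(x+ζ)]`, for EVERY probability measure `P` (uniformity in the scale);
  `uniformContinuous_integral_shift`.
* `opNorm₂_le_sum_abs_apply_single` — a continuous bilinear form on `ℝ^N` is controlled by its matrix
  entries: `‖L‖ ≤ Σ_{ij} |L(e_i,e_j)|` (Horn–Johnson §5.6).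
* `hasFDerivAt_fderiv_mul`, `norm_fderiv₂_mul_le` — the second Fréchet derivative of a product
  `f·g` of twice differentiable scalar functions as a continuous bilinear map,
  `D²(fg) = f D²g + Df ⊗ Dg + g D²f + Dg ⊗ Df`, with the norm bound
  `‖D²(fg)‖ ≤ |f|‖D²g‖ + 2‖Df‖‖Dg‖ + |g|‖D²f‖`.

Nothing here concerns Yang–Mills.

## References

* [BauerschmidtBodineauDagallier2023] R. Bauerschmidt, T. Bodineau, B. Dagallier, Probab. Surveys 21
  (2024) 200–290, arXiv:2307.07619 — §3.2 Prop 8 (proof) p0015 L1–8, Lemma 1 (proof) p0017 L1–30,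
  Lemma 2 p0017. READ (held).
* [HornJohnson2013] R. A. Horn, C. R. Johnson, Matrix Analysis, 2nd ed., CUP 2013 — §5.6 (matrix norms).
-/

noncomputable section

-- nested operator-norm instances `E →L[ℝ] E →L[ℝ] ℝ` (as in Mathlib's bilinear-map files)
set_option maxSynthPendingDepth 2

open MeasureTheory ProbabilityTheory Filter Topology Set
open scoped RealInnerProductSpace Matrix MatrixOrder

namespace Literature.Analysis.FunctionSpaces

namespace Polchinski

variable {N : ℕ}

section Smoothing

variable {Y : Type*} [NormedAddCommGroup Y] [NormedSpace ℝ Y]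

omit [NormedSpace ℝ Y] in
/-- `x ↦ H(x + ζ)` is integrable for bounded continuous Banach-valued `H` and a finite measure. [folklore] -/
private theorem integrable_shift_of_norm_le {H : EuclideanSpace ℝ (Fin N) → Y} (hHc : Continuous H)
    {MH : ℝ} (hH : ∀ x, ‖H x‖ ≤ MH) (P : Measure (EuclideanSpace ℝ (Fin N))) [IsFiniteMeasure P]
    (x : EuclideanSpace ℝ (Fin N)) : Integrable (fun ζ => H (x + ζ)) P :=
  Integrable.of_bound (hHc.comp (continuous_const.add continuous_id)).aestronglyMeasurable MH
    (Eventually.of_forall fun ζ => hH (x + ζ))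

/-- **Smoothing preserves sup bounds**: `‖E_P[H(x+ζ)]‖ ≤ sup ‖H‖` for every probability measure `P`
(«`‖P_{s,t}F‖_∞ ≤ ‖F‖_∞`», [BBD] proof of Prop 8). [cite: BauerschmidtBodineauDagallier2023, Proposition 8 (proof)] -/
theorem norm_integral_shift_le {H : EuclideanSpace ℝ (Fin N) → Y}
    {MH : ℝ} (hH : ∀ x, ‖H x‖ ≤ MH) (P : Measure (EuclideanSpace ℝ (Fin N))) [IsProbabilityMeasure P]
    (x : EuclideanSpace ℝ (Fin N)) : ‖∫ ζ, H (x + ζ) ∂P‖ ≤ MH := by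
  have h := norm_integral_le_of_norm_le_const (μ := P) (f := fun ζ => H (x + ζ)) (C := MH)
    (Eventually.of_forall fun ζ => hH (x + ζ))
  rwa [probReal_univ, mul_one] at h

/-- **Smoothing preserves moduli of continuity, uniformly in the measure**: if `‖H u − H v‖ ≤ ε`
whenever `‖u − v‖ < δ`, then `‖E_P[H(x+ζ)] − E_P[H(y+ζ)]‖ ≤ ε` whenever `‖x − y‖ < δ`, for EVERY
probability measure `P` — so the Gaussian averages `E_{C_t}[H(·+ζ)]`, `t ≥ 0`, are uniformly
equicontinuous (the regularity of `Z_t = e^{−V_t}` and its derivatives is that of `e^{−V₀}`, [BBD] Lemma 2).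
[cite: BauerschmidtBodineauDagallier2023, Lemma 2 (proof)] -/
theorem norm_integral_shift_sub_integral_shift_le {H : EuclideanSpace ℝ (Fin N) → Y}
    (hHc : Continuous H) {MH : ℝ} (hH : ∀ x, ‖H x‖ ≤ MH) {ε δ : ℝ}
    (hUCδ : ∀ u v, ‖u - v‖ < δ → ‖H u - H v‖ ≤ ε)
    (P : Measure (EuclideanSpace ℝ (Fin N))) [IsProbabilityMeasure P]
    {x y : EuclideanSpace ℝ (Fin N)} (hxy : ‖x - y‖ < δ) :
    ‖(∫ ζ, H (x + ζ) ∂P) - ∫ ζ, H (y + ζ) ∂P‖ ≤ ε := by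
  rw [← integral_sub (integrable_shift_of_norm_le hHc hH P x) (integrable_shift_of_norm_le hHc hH P y)]
  have h := norm_integral_le_of_norm_le_const (μ := P) (f := fun ζ => H (x + ζ) - H (y + ζ)) (C := ε)
    (Eventually.of_forall fun ζ => hUCδ _ _ (by simpa using hxy))
  rwa [probReal_univ, mul_one] at h

/-- **Gaussian (or any) smoothing of a bounded uniformly continuous map is uniformly continuous.**
[cite: BauerschmidtBodineauDagallier2023, Lemma 2 (proof)] -/
theorem uniformContinuous_integral_shift {H : EuclideanSpace ℝ (Fin N) → Y}
    (hHc : Continuous H) {MH : ℝ} (hH : ∀ x, ‖H x‖ ≤ MH) (hUC : UniformContinuous H)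
    (P : Measure (EuclideanSpace ℝ (Fin N))) [IsProbabilityMeasure P] :
    UniformContinuous fun x => ∫ ζ, H (x + ζ) ∂P := by
  rw [Metric.uniformContinuous_iff]
  intro ε hε
  obtain ⟨δ, hδ, h⟩ := Metric.uniformContinuous_iff.mp hUC (ε / 2) (half_pos hε)
  refine ⟨δ, hδ, fun {x y} hxy => ?_⟩
  have hUCδ : ∀ u v, ‖u - v‖ < δ → ‖H u - H v‖ ≤ ε / 2 := fun u v huv => by
    have h' := h (a := u) (b := v) (by rwa [dist_eq_norm])
    rw [dist_eq_norm] at h'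
    exact h'.le
  rw [dist_eq_norm] at hxy ⊢
  exact (norm_integral_shift_sub_integral_shift_le hHc hH hUCδ P hxy).trans_lt (half_lt_self hε)

end Smoothing

section Bilinear

/-- **Entries control a bilinear form**: `|L u v| ≤ ‖u‖ ‖v‖ Σ_{ij} |L(e_i,e_j)|` on `ℝ^N`. [folklore] -/
private theorem abs_apply₂_le_sum_abs_apply_single
    (L : EuclideanSpace ℝ (Fin N) →L[ℝ] EuclideanSpace ℝ (Fin N) →L[ℝ] ℝ)
    (u v : EuclideanSpace ℝ (Fin N)) :
    |L u v| ≤ ‖u‖ * ‖v‖ *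
      ∑ i, ∑ j, |L (EuclideanSpace.single i 1) (EuclideanSpace.single j 1)| := by
  -- expand `u`, `v` in the standard basis
  have hu : u = ∑ i, u i • EuclideanSpace.single i (1:ℝ) := by
    simpa [EuclideanSpace.basisFun_apply, EuclideanSpace.basisFun_repr] using
      ((EuclideanSpace.basisFun (Fin N) ℝ).sum_repr u).symm
  have hv : v = ∑ j, v j • EuclideanSpace.single j (1:ℝ) := by
    simpa [EuclideanSpace.basisFun_apply, EuclideanSpace.basisFun_repr] using
      ((EuclideanSpace.basisFun (Fin N) ℝ).sum_repr v).symm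
  have h1 : L u v = ∑ i, u i * L (EuclideanSpace.single i 1) v := by
    conv_lhs => rw [hu]
    simp only [map_sum, map_smul, _root_.sum_apply, _root_.smul_apply, smul_eq_mul]
  have h2 : ∀ i, L (EuclideanSpace.single i 1) v =
      ∑ j, v j * L (EuclideanSpace.single i 1) (EuclideanSpace.single j 1) := fun i => by
    conv_lhs => rw [hv]
    simp only [map_sum, map_smul, smul_eq_mul]
  have hexp : L u v = ∑ i, ∑ j, u i * v j *
      L (EuclideanSpace.single i 1) (EuclideanSpace.single j 1) := by
    rw [h1]
    refine Finset.sum_congr rfl fun i _ => ?_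
    rw [h2 i, Finset.mul_sum]
    refine Finset.sum_congr rfl fun j _ => ?_
    ring
  rw [hexp]
  have hui : ∀ i, |u i| ≤ ‖u‖ := fun i => by
    have h := PiLp.norm_apply_le u i
    rwa [Real.norm_eq_abs] at h
  have hvj : ∀ j, |v j| ≤ ‖v‖ := fun j => by
    have h := PiLp.norm_apply_le v j
    rwa [Real.norm_eq_abs] at h
  rw [Finset.mul_sum]
  refine (Finset.abs_sum_le_sum_abs _ _).trans (Finset.sum_le_sum fun i _ => ?_)
  rw [Finset.mul_sum]
  refine (Finset.abs_sum_le_sum_abs _ _).trans (Finset.sum_le_sum fun j _ => ?_)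
  rw [abs_mul, abs_mul]
  exact mul_le_mul_of_nonneg_right
    (mul_le_mul (hui i) (hvj j) (abs_nonneg _) (norm_nonneg _)) (abs_nonneg _)

/-- **Operator norm of a bilinear form on `ℝ^N` is at most the sum of the absolute entries**,
`‖L‖ ≤ Σ_{ij} |L(e_i,e_j)|` (so entrywise smallness of `Hess Z_r − Hess Z_t` gives smallness in norm,
as needed to feed the norm-modulus hypotheses of the two-scale lemmas); the operator (spectral) norm is
dominated by the entrywise `ℓ¹` norm. [cite: HornJohnson2013, §5.6 (matrix norms: ‖A‖₂ ≤ Σ|a_ij|)] -/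
theorem opNorm₂_le_sum_abs_apply_single
    (L : EuclideanSpace ℝ (Fin N) →L[ℝ] EuclideanSpace ℝ (Fin N) →L[ℝ] ℝ) :
    ‖L‖ ≤ ∑ i, ∑ j, |L (EuclideanSpace.single i 1) (EuclideanSpace.single j 1)| := by
  have hS : 0 ≤ ∑ i, ∑ j, |L (EuclideanSpace.single i (1:ℝ)) (EuclideanSpace.single j (1:ℝ))| :=
    Finset.sum_nonneg fun i _ => Finset.sum_nonneg fun j _ => abs_nonneg _
  refine ContinuousLinearMap.opNorm_le_bound _ hS fun u => ?_
  refine ContinuousLinearMap.opNorm_le_bound _ (mul_nonneg hS (norm_nonneg _)) fun v => ?_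
  rw [Real.norm_eq_abs]
  calc |L u v| ≤ ‖u‖ * ‖v‖ * ∑ i, ∑ j, |L (EuclideanSpace.single i 1) (EuclideanSpace.single j 1)| :=
        abs_apply₂_le_sum_abs_apply_single L u v
    _ = (∑ i, ∑ j, |L (EuclideanSpace.single i 1) (EuclideanSpace.single j 1)|) * ‖u‖ * ‖v‖ := by
        ring

end Bilinear

section ProductRule

variable {f g : EuclideanSpace ℝ (Fin N) → ℝ}
  {f1 g1 : EuclideanSpace ℝ (Fin N) → EuclideanSpace ℝ (Fin N) →L[ℝ] ℝ}
  {f2 g2 : EuclideanSpace ℝ (Fin N) → EuclideanSpace ℝ (Fin N) →L[ℝ] EuclideanSpace ℝ (Fin N) →L[ℝ] ℝ}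

/-- **Product rule, second derivative**: the derivative of `x ↦ f(x) Dg(x) + g(x) Df(x)` is the continuous
bilinear map `f D²g + Df ⊗ Dg + g D²f + Dg ⊗ Df` (`⊗` realised by `smulRight`), i.e.
`D²(fg)(u,v) = f D²g(u,v) + Df(u)Dg(v) + g D²f(u,v) + Dg(u)Df(v)`. [cite: BauerschmidtBodineauDagallier2023, Lemma 1 (proof, product rules)] -/
theorem hasFDerivAt_fderiv_mul (hf1 : ∀ x, HasFDerivAt f (f1 x) x) (hf2 : ∀ x, HasFDerivAt f1 (f2 x) x)
    (hg1 : ∀ x, HasFDerivAt g (g1 x) x) (hg2 : ∀ x, HasFDerivAt g1 (g2 x) x)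
    (x : EuclideanSpace ℝ (Fin N)) :
    HasFDerivAt (fun x => f x • g1 x + g x • f1 x)
      (f x • g2 x + (f1 x).smulRight (g1 x) + (g x • f2 x + (g1 x).smulRight (f1 x))) x :=
  ((hf1 x).smul (hg2 x)).add ((hg1 x).smul (hf2 x))

/-- Entries of the product Hessian: `D²(fg)(u,v) = f D²g(u,v) + Df(u)Dg(v) + g D²f(u,v) + Dg(u)Df(v)`
(the index form `(FG)_{ik} = F G_{ik} + F_iG_k + G F_{ik} + G_iF_k` used in [BBD]'s proof of Lemma 1).
[cite: BauerschmidtBodineauDagallier2023, Lemma 1 (proof)] -/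
theorem fderiv₂_mul_apply (x u v : EuclideanSpace ℝ (Fin N)) :
    (f x • g2 x + (f1 x).smulRight (g1 x) + (g x • f2 x + (g1 x).smulRight (f1 x))) u v =
      f x * g2 x u v + f1 x u * g1 x v + (g x * f2 x u v + g1 x u * f1 x v) := by
  simp only [_root_.add_apply, _root_.smul_apply, smul_eq_mul, ContinuousLinearMap.smulRight_apply]

/-- **Norm bound for the product Hessian**: `‖D²(fg)‖ ≤ |f|‖D²g‖ + ‖Df‖‖Dg‖ + |g|‖D²f‖ + ‖Dg‖‖Df‖`.
[cite: BauerschmidtBodineauDagallier2023, Lemma 1 (proof)] -/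
theorem norm_fderiv₂_mul_le (x : EuclideanSpace ℝ (Fin N)) :
    ‖f x • g2 x + (f1 x).smulRight (g1 x) + (g x • f2 x + (g1 x).smulRight (f1 x))‖ ≤
      |f x| * ‖g2 x‖ + ‖f1 x‖ * ‖g1 x‖ + (|g x| * ‖f2 x‖ + ‖g1 x‖ * ‖f1 x‖) := by
  have a1 : ‖f x • g2 x‖ ≤ |f x| * ‖g2 x‖ := le_of_eq (by rw [norm_smul, Real.norm_eq_abs])
  have a2 : ‖(f1 x).smulRight (g1 x)‖ ≤ ‖f1 x‖ * ‖g1 x‖ :=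
    le_of_eq (ContinuousLinearMap.norm_smulRight_apply _ _)
  have a3 : ‖g x • f2 x‖ ≤ |g x| * ‖f2 x‖ := le_of_eq (by rw [norm_smul, Real.norm_eq_abs])
  have a4 : ‖(g1 x).smulRight (f1 x)‖ ≤ ‖g1 x‖ * ‖f1 x‖ :=
    le_of_eq (ContinuousLinearMap.norm_smulRight_apply _ _)
  exact norm_add_le_of_le (norm_add_le_of_le a1 a2) (norm_add_le_of_le a3 a4)

/-- **Uniform bound for the product Hessian** from bounds on the factors:
`‖D²(fg)‖ ≤ K_f M_g + 2 K'_f K'_g + K_g M_f` (so products of `C_b²` functions are `C_b²`, the class on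
which the Polchinski semigroup acts, [BBD] §3.2). [cite: BauerschmidtBodineauDagallier2023, Lemma 1 (proof)] -/
theorem norm_fderiv₂_mul_le_of_bounds {Kf Kg Kf1 Kg1 Mf Mg : ℝ}
    (hf : ∀ x, |f x| ≤ Kf) (hg : ∀ x, |g x| ≤ Kg) (hf1b : ∀ x, ‖f1 x‖ ≤ Kf1) (hg1b : ∀ x, ‖g1 x‖ ≤ Kg1)
    (hf2b : ∀ x, ‖f2 x‖ ≤ Mf) (hg2b : ∀ x, ‖g2 x‖ ≤ Mg) (x : EuclideanSpace ℝ (Fin N)) :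
    ‖f x • g2 x + (f1 x).smulRight (g1 x) + (g x • f2 x + (g1 x).smulRight (f1 x))‖ ≤
      Kf * Mg + Kf1 * Kg1 + (Kg * Mf + Kg1 * Kf1) := by
  have h0f : 0 ≤ Kf := le_trans (abs_nonneg _) (hf x)
  have h0g : 0 ≤ Kg := le_trans (abs_nonneg _) (hg x)
  have h0f1 : 0 ≤ Kf1 := le_trans (norm_nonneg _) (hf1b x)
  have h0g1 : 0 ≤ Kg1 := le_trans (norm_nonneg _) (hg1b x)
  refine (norm_fderiv₂_mul_le x).trans ?_
  exact add_le_add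
    (add_le_add (mul_le_mul (hf x) (hg2b x) (norm_nonneg _) h0f)
      (mul_le_mul (hf1b x) (hg1b x) (norm_nonneg _) h0f1))
    (add_le_add (mul_le_mul (hg x) (hf2b x) (norm_nonneg _) h0g)
      (mul_le_mul (hg1b x) (hf1b x) (norm_nonneg _) h0g1))

end ProductRule

end Polchinski

end Literature.Analysis.FunctionSpaces

end
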